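import Summits.Ventures.Crystal3D.Theorems.StickyWulffConstantTextureLiminfTexShadowLevelReachFourFamilyPooled
import Summits.Ventures.Crystal3D.Theorems.StickyWulffConstantCoaxialWallLawPlateSystemAdmPresent
import Summits.Ventures.Crystal3D.Theorems.StickyWulffConstantCoaxialWallLawOnSiteTools
import Summits.Ventures.Crystal3D.Theorems.StickyWulffConstantCoaxialWallLawBarlowWindowHeights
import HarnessLib

/-!
# The four-family pooled census for the PLATE-ADJACENT lamellae: presentation and direction separation DISCHARGED (one-letter classes)
# (lane T, crux `TextureLiminfV5`, stmt-Ventures-23912, registered stub `stub_terraceCensus`; (β) assembly RESUME (d) — cf-p1 (cccxii); memo PRESENTABLE-SUPPLY-g24 §4)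

HONEST FRAMING. Venture `Summits/Ventures/Crystal3D` (cell `crystal3d-full`), route `route-Ventures-StickyWulffConstant`, helper `--supports` the law-v5
crux `TextureLiminfV5` (stmt-Ventures-23912), lane T, mechanism (β).  Census-free, certificate-free (the row `LocalEndRowA ver sF (basalSystem Fr) (basalSystem G₂)`
BY NAME); `KissingGap δ` / `KissingClassification δ` by name; nothing about energies; F-C1 not moved.

THE POINT.  `fourFamily_sources_le_payers_cuts` (…LevelReachFourFamilyPooled) for the born families OF RECORD (PRESENTABLE-SUPPLY-g24 §3(b)/§4: the presentable
born supply of the two-system census object sits in the lamellae ADJACENT to the plates): launch frames `A₁ = M_{μ₁} ≫ Fr = (basalSystem Fr).Fw [μ₁]` along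
`A₁ (−r₁)` and `A₂ = M_{μ₂} ≫ G₂` along `A₂ (−r₂)`, `r_i` BASAL slots off the letter planes (`⟪r_i, μ_i⟫ ≠ 0`), `μ_i` unit model menu normals.  Two of the
pooled theorem's hypotheses are then theorems:
* PRESENTATION `hadm_i` — `PlateSystem.adm_fw_singleton_of_crossed` (19480-p2, p750661): `(basalSystem Fr).Adm A₁ (A₁ (−r₁))`;
* DIRECTION SEPARATION `hdir_i` — **`fw_singleton_neg_ne_basal`**: `A₁ (−r₁) = −Fr (M_{μ₁} r₁)` is no basal direction `Fr r'` of the plate, because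
  `(M_μ r)₂ = −2⟪r, μ⟫ μ₂ ≠ 0` for a basal `r` (`r₂ = 0`), a model menu normal `μ` (`μ₂ ∈ {±1, ±1/3}`, lane F's `modelNormal_apply_two`) and `⟪r, μ⟫ ≠ 0`
  (**`reflection_basal_apply_two_ne_zero`**).
Output **`fourFamily_oneLetter_sources_le_payers_cuts`**: the four-family inequality with only the GEOMETRIC hypotheses left — the one-letter dozens are not plate
dozens of the far plate (`hneA`), the born directions rise / fall (`hup₁`, `hdown₂`) — plus the cell, the born launch sets and the row by name.
WHAT THIS IS NOT: born SUPPLY (the riser law: a lower bound on the born launch counts), the flux/area conversion, any certificate; F-C1 not moved.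
-/

noncomputable section

namespace Summit.Ventures.Crystal3D.Theorems

open Summit.Ventures.Crystal3D Finset
open Literature.MathematicalPhysics.StatisticalMechanics (barlowPos barlowStacking IsHaggSeq barlowPos_mem basalMirror)
open Summit.Ventures.Crystal3D.Cruxes.TextureLiminf.TexShadow (E3 stacking)
open scoped InnerProductSpace

/-- **A basal slot reflected in a crossing letter plane leaves the basal plane**: `((ℝ ∙ μ)ᗮ.reflection r)₂ ≠ 0` for a basal slot `r`, a unit model menu
normal `μ` and `⟪r, μ⟫ ≠ 0` (the height is `−2⟪r, μ⟫ μ₂` with `μ₂ ∈ {±1, ±1/3}`). -/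
theorem reflection_basal_apply_two_ne_zero {r μ : E3} (hr : r ∈ basalHexagon) (hμ1 : ‖μ‖ = 1)
    (hμmenu : ∀ w ∈ fccSlots, ⟪w, μ⟫_ℝ = 0 ∨ ⟪w, μ⟫_ℝ = Real.sqrt (2 / 3) ∨ ⟪w, μ⟫_ℝ = -Real.sqrt (2 / 3))
    (hcross : ⟪r, μ⟫_ℝ ≠ 0) : ((ℝ ∙ μ)ᗮ.reflection r) 2 ≠ 0 := by
  have hr2 : r 2 = 0 := (mem_filter.1 hr).2
  have hμ2 := modelNormal_apply_two (mem_modelNormals_of_menu hμ1 hμmenu)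
  rw [reflection_unit_apply hμ1, PiLp.sub_apply, PiLp.smul_apply, smul_eq_mul, hr2, zero_sub, neg_ne_zero]
  refine mul_ne_zero (mul_ne_zero two_ne_zero hcross) ?_
  rcases hμ2 with h | h | h | h <;> rw [h] <;> norm_num

/-- **Direction separation for a one-letter born family**: along the frame `M_μ ≫ G₀` the direction `(M_μ ≫ G₀)(−r)` of a basal root `r` crossing the
letter `μ` is none of the frame `G₀`'s basal directions. -/
theorem fw_singleton_neg_ne_basal (G₀ : E3 ≃ₗᵢ[ℝ] E3) {r μ : E3} (hr : r ∈ basalHexagon) (hμ1 : ‖μ‖ = 1)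
    (hμmenu : ∀ w ∈ fccSlots, ⟪w, μ⟫_ℝ = 0 ∨ ⟪w, μ⟫_ℝ = Real.sqrt (2 / 3) ∨ ⟪w, μ⟫_ℝ = -Real.sqrt (2 / 3))
    (hcross : ⟪r, μ⟫_ℝ ≠ 0) :
    ∀ r' ∈ basalHexagon, (((ℝ ∙ μ)ᗮ.reflection).trans G₀) (-r) ≠ G₀ r' := by
  intro r' hr' heq
  have hr'2 : r' 2 = 0 := (mem_filter.1 hr').2
  rw [LinearIsometryEquiv.trans_apply, map_neg] at heq
  have e : -((ℝ ∙ μ)ᗮ.reflection r) = r' := G₀.injective heq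
  have := congrArg (fun v : E3 => v 2) e
  simp only [PiLp.neg_apply, hr'2, neg_eq_zero] at this
  exact reflection_basal_apply_two_ne_zero hr hμ1 hμmenu hcross this

set_option maxHeartbeats 800000 in
open scoped Classical in
/-- **Four families, one-letter born classes** — `fourFamily_sources_le_payers_cuts` with the presentation and direction-separation hypotheses
DISCHARGED for `A₁ = M_{μ₁} ≫ Fr`, `w₁ = −r₁` and `A₂ = M_{μ₂} ≫ G₂`, `w₂ = −r₂` (`r_i` basal, `⟪r_i, μ_i⟫ ≠ 0`, `μ_i` unit model menu normals). -/
theorem fourFamily_oneLetter_sources_le_payers_cuts (ver : WordVersion) {δ : ℝ} (hg : KissingGap δ) (hc : KissingClassification δ)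
    {σ₁ σ₂ : ℤ → ℤ} (hσ₁ : IsHaggSeq σ₁) (hσ₂ : IsHaggSeq σ₂) (L₁ L₂ : E3 ≃ₗᵢ[ℝ] E3) (s₁ s₂ : E3)
    (Fr : E3 ≃ₗᵢ[ℝ] E3) {t : ℤ} (hFr : (t = 1 ∧ Fr = L₁) ∨ (t = -1 ∧ Fr = basalMirror.trans L₁))
    (G₂ : E3 ≃ₗᵢ[ℝ] E3) {t' : ℤ} (hG₂ : (t' = 1 ∧ G₂ = L₂) ∨ (t' = -1 ∧ G₂ = basalMirror.trans L₂))
    (hne₁ : (Fr : E3 → E3) '' ↑fccSlots ≠ (L₂ : E3 → E3) '' ↑fccSlots)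
    (hne₂ : (Fr : E3 → E3) '' ↑fccSlots ≠ ((basalMirror.trans L₂ : E3 ≃ₗᵢ[ℝ] E3) : E3 → E3) '' ↑fccSlots)
    (hne₁' : (G₂ : E3 → E3) '' ↑fccSlots ≠ (L₁ : E3 → E3) '' ↑fccSlots)
    (hne₂' : (G₂ : E3 → E3) '' ↑fccSlots ≠ ((basalMirror.trans L₁ : E3 ≃ₗᵢ[ℝ] E3) : E3 → E3) '' ↑fccSlots)
    -- the rising born family of the lamella across the letter `μ₁` of the bottom plate
    {μ₁ r₁ : E3} (hμ₁1 : ‖μ₁‖ = 1)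
    (hμ₁menu : ∀ w ∈ fccSlots, ⟪w, μ₁⟫_ℝ = 0 ∨ ⟪w, μ₁⟫_ℝ = Real.sqrt (2 / 3) ∨ ⟪w, μ₁⟫_ℝ = -Real.sqrt (2 / 3))
    (hr₁ : r₁ ∈ basalHexagon) (hcross₁ : ⟪r₁, μ₁⟫_ℝ ≠ 0)
    (hneA₁ : ((((ℝ ∙ μ₁)ᗮ.reflection).trans Fr : E3 ≃ₗᵢ[ℝ] E3) : E3 → E3) '' ↑fccSlots ≠ (L₂ : E3 → E3) '' ↑fccSlots)
    (hneA₁' : ((((ℝ ∙ μ₁)ᗮ.reflection).trans Fr : E3 ≃ₗᵢ[ℝ] E3) : E3 → E3) '' ↑fccSlots ≠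
      ((basalMirror.trans L₂ : E3 ≃ₗᵢ[ℝ] E3) : E3 → E3) '' ↑fccSlots)
    (hup₁ : 0 < ((((ℝ ∙ μ₁)ᗮ.reflection).trans Fr) (-r₁)) 2)
    -- the falling born family of the lamella across the letter `μ₂` of the top plate
    {μ₂ r₂ : E3} (hμ₂1 : ‖μ₂‖ = 1)
    (hμ₂menu : ∀ w ∈ fccSlots, ⟪w, μ₂⟫_ℝ = 0 ∨ ⟪w, μ₂⟫_ℝ = Real.sqrt (2 / 3) ∨ ⟪w, μ₂⟫_ℝ = -Real.sqrt (2 / 3))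
    (hr₂ : r₂ ∈ basalHexagon) (hcross₂ : ⟪r₂, μ₂⟫_ℝ ≠ 0)
    (hneA₂ : ((((ℝ ∙ μ₂)ᗮ.reflection).trans G₂ : E3 ≃ₗᵢ[ℝ] E3) : E3 → E3) '' ↑fccSlots ≠ (L₁ : E3 → E3) '' ↑fccSlots)
    (hneA₂' : ((((ℝ ∙ μ₂)ᗮ.reflection).trans G₂ : E3 ≃ₗᵢ[ℝ] E3) : E3 → E3) '' ↑fccSlots ≠
      ((basalMirror.trans L₁ : E3 ≃ₗᵢ[ℝ] E3) : E3 → E3) '' ↑fccSlots)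
    (hdown₂ : ((((ℝ ∙ μ₂)ᗮ.reflection).trans G₂) (-r₂)) 2 < 0)
    {sF : ℝ} (hrow : LocalEndRowA ver sF (basalSystem Fr) (basalSystem G₂))
    (X P₁ P₂ : Finset E3) (R₀ h ρ : ℝ) (hR₀ : 5 ≤ R₀) (hρ : R₀ + 2 ≤ ρ)
    (hX : ∀ p ∈ X, ∀ q ∈ X, p ≠ q → 1 ≤ dist p q) (hP₁X : P₁ ⊆ X) (hP₂X : P₂ ⊆ X)
    (hP₁ : ∀ p, p ∈ P₁ ↔ (p ∈ stacking L₁ s₁ σ₁ ∧ -(2 * R₀) ≤ p 2 ∧ p 2 ≤ -R₀ ∧ p 0 ^ 2 + p 1 ^ 2 ≤ ρ ^ 2))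
    (hP₂ : ∀ p, p ∈ P₂ ↔ (p ∈ stacking L₂ s₂ σ₂ ∧ h + R₀ ≤ p 2 ∧ p 2 ≤ h + 2 * R₀ ∧ p 0 ^ 2 + p 1 ^ 2 ≤ ρ ^ 2))
    (B₁ B₂ : Finset E3)
    (hborn₁ : ∀ p ∈ B₁, p ∈ X ∧ IsFull X (((ℝ ∙ μ₁)ᗮ.reflection).trans Fr) p ∧ p - (((ℝ ∙ μ₁)ᗮ.reflection).trans Fr) (-r₁) ∈ X ∧
      ¬ (p - (((ℝ ∙ μ₁)ᗮ.reflection).trans Fr) (-r₁) - (((ℝ ∙ μ₁)ᗮ.reflection).trans Fr) (-r₁) ∈ X ∧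
        (IsFull X (((ℝ ∙ μ₁)ᗮ.reflection).trans Fr) (p - (((ℝ ∙ μ₁)ᗮ.reflection).trans Fr) (-r₁)) ∨
          (∃ m, IsTwinReading X (((ℝ ∙ μ₁)ᗮ.reflection).trans Fr) m (p - (((ℝ ∙ μ₁)ᗮ.reflection).trans Fr) (-r₁)) ∧
            ⟪(((ℝ ∙ μ₁)ᗮ.reflection).trans Fr) (-r₁), m⟫_ℝ = 0) ∨
          (ver = WordVersion.v2 ∧ IsNarrow X (((ℝ ∙ μ₁)ᗮ.reflection).trans Fr) ((((ℝ ∙ μ₁)ᗮ.reflection).trans Fr) (-r₁))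
            (p - (((ℝ ∙ μ₁)ᗮ.reflection).trans Fr) (-r₁))))))
    (hborn₂ : ∀ p ∈ B₂, p ∈ X ∧ IsFull X (((ℝ ∙ μ₂)ᗮ.reflection).trans G₂) p ∧ p - (((ℝ ∙ μ₂)ᗮ.reflection).trans G₂) (-r₂) ∈ X ∧
      ¬ (p - (((ℝ ∙ μ₂)ᗮ.reflection).trans G₂) (-r₂) - (((ℝ ∙ μ₂)ᗮ.reflection).trans G₂) (-r₂) ∈ X ∧
        (IsFull X (((ℝ ∙ μ₂)ᗮ.reflection).trans G₂) (p - (((ℝ ∙ μ₂)ᗮ.reflection).trans G₂) (-r₂)) ∨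
          (∃ m, IsTwinReading X (((ℝ ∙ μ₂)ᗮ.reflection).trans G₂) m (p - (((ℝ ∙ μ₂)ᗮ.reflection).trans G₂) (-r₂)) ∧
            ⟪(((ℝ ∙ μ₂)ᗮ.reflection).trans G₂) (-r₂), m⟫_ℝ = 0) ∨
          (ver = WordVersion.v2 ∧ IsNarrow X (((ℝ ∙ μ₂)ᗮ.reflection).trans G₂) ((((ℝ ∙ μ₂)ᗮ.reflection).trans G₂) (-r₂))
            (p - (((ℝ ∙ μ₂)ᗮ.reflection).trans G₂) (-r₂)))))) :
    ((∑ r ∈ inPlaneRoots Fr 1,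
        ((P₁.filter fun p => -(R₀ + 1) - 1 - 1 ≤ p 2 ∧ p 2 ≤ -(R₀ + 1) - 1 ∧ p 0 ^ 2 + p 1 ^ 2 ≤ (ρ - 1 - 1) ^ 2).filter
          fun p => (∃ k i j : ℤ, p = L₁ (barlowPos 1 (Real.sqrt (2 / 3)) σ₁ k i j) + s₁ ∧ ¬ (σ₁ (k - 1) = -t ∧ σ₁ k = -t)) ∧
            -(R₀ + 1) - 1 < (p + Fr r) 2 ∧ (p + Fr r) 2 < h + (R₀ + 1) + 1).card : ℕ) : ℝ) +
      ((∑ r ∈ inPlaneRoots G₂ (-1),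
        ((P₂.filter fun p => h + (R₀ + 1) + 1 ≤ p 2 ∧ p 2 ≤ h + (R₀ + 1) + 1 + 1 ∧ p 0 ^ 2 + p 1 ^ 2 ≤ (ρ - 1 - 1) ^ 2).filter
          fun p => (∃ k i j : ℤ, p = L₂ (barlowPos 1 (Real.sqrt (2 / 3)) σ₂ k i j) + s₂ ∧ ¬ (σ₂ (k - 1) = -t' ∧ σ₂ k = -t')) ∧
            -(R₀ + 1) - 1 < (p + G₂ r) 2 ∧ (p + G₂ r) 2 < h + (R₀ + 1) + 1).card : ℕ) : ℝ) +
      ((B₁.filter fun p => -(R₀ + 1) - 1 < (p + (((ℝ ∙ μ₁)ᗮ.reflection).trans Fr) (-r₁)) 2 ∧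
          (p + (((ℝ ∙ μ₁)ᗮ.reflection).trans Fr) (-r₁)) 2 < h + (R₀ + 1) + 1).card : ℝ) +
      ((B₂.filter fun p => -(R₀ + 1) - 1 < (p + (((ℝ ∙ μ₂)ᗮ.reflection).trans G₂) (-r₂)) 2 ∧
          (p + (((ℝ ∙ μ₂)ᗮ.reflection).trans G₂) (-r₂)) 2 < h + (R₀ + 1) + 1).card : ℝ) ≤
      sF * ∑ z ∈ X.filter (fun z => (X.filter fun q => dist z q = 1).card ≤ 11 ∧
          -(R₀ + 1) - 2 ≤ z 2 ∧ z 2 ≤ h + (R₀ + 1) + 2), ((12 : ℝ) - ((X.filter fun q => dist z q = 1).card : ℝ)) +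
        ((∑ r ∈ inPlaneRoots Fr 1, (X.filter fun b => -(R₀ + 1) - 1 ≤ b 2 ∧ b 2 < h + (R₀ + 1) + 1 ∧
            (∃ μ, ⟪r, μ⟫_ℝ = Real.sqrt (2 / 3) ∧ IsTwinReading X Fr (Fr μ) b) ∧ b - Fr r ∈ X).card : ℕ) : ℝ) +
        ((∑ r ∈ inPlaneRoots G₂ (-1), (X.filter fun b => -(R₀ + 1) - 1 < b 2 ∧ b 2 ≤ h + (R₀ + 1) + 1 ∧
            (∃ μ, ⟪r, μ⟫_ℝ = Real.sqrt (2 / 3) ∧ IsTwinReading X G₂ (G₂ μ) b) ∧ b - G₂ r ∈ X).card : ℕ) : ℝ) +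
        ((X.filter fun b => -(R₀ + 1) - 1 ≤ b 2 ∧ b 2 < h + (R₀ + 1) + 1 ∧
            (∃ μ, ⟪-r₁, μ⟫_ℝ = Real.sqrt (2 / 3) ∧ IsTwinReading X (((ℝ ∙ μ₁)ᗮ.reflection).trans Fr) ((((ℝ ∙ μ₁)ᗮ.reflection).trans Fr) μ) b) ∧
            b - (((ℝ ∙ μ₁)ᗮ.reflection).trans Fr) (-r₁) ∈ X).card : ℝ) +
        ((X.filter fun b => -(R₀ + 1) - 1 < b 2 ∧ b 2 ≤ h + (R₀ + 1) + 1 ∧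
            (∃ μ, ⟪-r₂, μ⟫_ℝ = Real.sqrt (2 / 3) ∧ IsTwinReading X (((ℝ ∙ μ₂)ᗮ.reflection).trans G₂) ((((ℝ ∙ μ₂)ᗮ.reflection).trans G₂) μ) b) ∧
            b - (((ℝ ∙ μ₂)ᗮ.reflection).trans G₂) (-r₂) ∈ X).card : ℝ) +
        (((inPlaneRoots Fr 1).card : ℝ) + 1) *
          (220 * ((X.filter fun s => h + (R₀ + 1) + 1 ≤ s 2 ∧ s 2 ≤ h + (R₀ + 1) + 1 + 1 ∧
              (ρ - 1 - 2) ^ 2 < s 0 ^ 2 + s 1 ^ 2).card : ℝ) +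
            220 * ((X.filter fun s => -(R₀ + 1) - 1 - 1 ≤ s 2 ∧ s 2 < -(R₀ + 1) - 1 ∧
              (ρ - 1 - 1) ^ 2 < s 0 ^ 2 + s 1 ^ 2).card : ℝ)) +
        (((inPlaneRoots G₂ (-1)).card : ℝ) + 1) *
          (220 * ((X.filter fun s => -(R₀ + 1) - 1 - 1 ≤ s 2 ∧ s 2 ≤ -(R₀ + 1) - 1 ∧
              (ρ - 1 - 2) ^ 2 < s 0 ^ 2 + s 1 ^ 2).card : ℝ) +
            220 * ((X.filter fun s => h + (R₀ + 1) + 1 < s 2 ∧ s 2 ≤ h + (R₀ + 1) + 1 + 1 ∧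
              (ρ - 1 - 1) ^ 2 < s 0 ^ 2 + s 1 ^ 2).card : ℝ)) := by
  -- presentation (19480-p2's one-letter `Adm` witnesses) and direction separation, then the pooled census
  have hRT₁ : (basalSystem Fr).RT ⊆ fccSlots := filter_subset _ _
  have hRT₂ : (basalSystem G₂).RT ⊆ fccSlots := filter_subset _ _
  have hadm₁ : (basalSystem Fr).Adm (((ℝ ∙ μ₁)ᗮ.reflection).trans Fr) ((((ℝ ∙ μ₁)ᗮ.reflection).trans Fr) (-r₁)) ∨
      (basalSystem G₂).Adm (((ℝ ∙ μ₁)ᗮ.reflection).trans Fr) ((((ℝ ∙ μ₁)ᗮ.reflection).trans Fr) (-r₁)) :=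
    Or.inl (PlateSystem.adm_fw_singleton_of_crossed (basalSystem Fr) hRT₁ hμ₁1 hμ₁menu hr₁ hcross₁)
  have hadm₂ : (basalSystem Fr).Adm (((ℝ ∙ μ₂)ᗮ.reflection).trans G₂) ((((ℝ ∙ μ₂)ᗮ.reflection).trans G₂) (-r₂)) ∨
      (basalSystem G₂).Adm (((ℝ ∙ μ₂)ᗮ.reflection).trans G₂) ((((ℝ ∙ μ₂)ᗮ.reflection).trans G₂) (-r₂)) :=
    Or.inr (PlateSystem.adm_fw_singleton_of_crossed (basalSystem G₂) hRT₂ hμ₂1 hμ₂menu hr₂ hcross₂)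
  have hdir₁ := fw_singleton_neg_ne_basal Fr hr₁ hμ₁1 hμ₁menu hcross₁
  have hdir₂ := fw_singleton_neg_ne_basal G₂ hr₂ hμ₂1 hμ₂menu hcross₂
  exact fourFamily_sources_le_payers_cuts ver hg hc hσ₁ hσ₂ L₁ L₂ s₁ s₂ Fr hFr G₂ hG₂ hne₁ hne₂ hne₁' hne₂'
    _ hneA₁ hneA₁' (neg_mem_fccSlots (hRT₁ hr₁)) hup₁ hadm₁ hdir₁
    _ hneA₂ hneA₂' (neg_mem_fccSlots (hRT₂ hr₂)) hdown₂ hadm₂ hdir₂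
    hrow X P₁ P₂ R₀ h ρ hR₀ hρ hX hP₁X hP₂X hP₁ hP₂ B₁ B₂ hborn₁ hborn₂

end Summit.Ventures.Crystal3D.Theorems

end
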